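/- Copyright: ym3-torus cell, WIDTH-5 ATTACH seat `ym-ust-19936-w4` (prover, g10), for crux `HistoryTailL` (stmt-QuantumFields-19936),
level-0 prefactor-free infrastructure (T4-UP, brick U1b) of LINE `local_insertion` (#13) ∕ K1.  Released under the licence of the surrounding project. -/
import Summits.QuantumFields.YangMills.Theorems.LocalInsertionTorusTopLinkD3
import HarnessLib

/-!
# (T4-UP, U1b) The SHARP top-link assignment on the THREE-torus (`#P = 2L³ − 2`) — d = 3 port of ✓`…CTorusTopLinkSharp`

Support file (`--supports stmt-QuantumFields-19936 --as helper`), cell ym3-torus level-0 programme, stage (T4) «uniform doubling»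
(LEAD ★w1-19936 g7; split ★w7 = T4-LOW, ★w4 = T4-UP).  The `d = 3` twin, letter for letter, of the route-`LangevinControlUV` file
✓`LangevinControlUVFemtoCurvatureTwoPointCTorusTopLinkSharp` (crux 16204, `d = 4`): for `L ≥ 2` a family `P` of `2L³ − 2`
plaquettes of `(ℤ∕L)³` (`P.card + 2 = 2L³`; Morse-optimal: `c₁ − c₀ ≥ b₁(T³) − b₀(T³) = 3 − 1` with the `L³` sites unmatched leaves
`L³ + 2` links unassigned = a spanning tree's `L³ − 1` plus the `3 = b₁(T³)` axis wrap links), an assignment `top` of one of its four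
links to each member, injective on `P`, and an injective rank (`2L`-adic digits `2xᵢ + [i = μ]`, coordinate `0` most significant)
with `top p` of maximal rank among the four links of `p` (`torus_topLink_assignment_sharp_d3`).  `#P = 2L³ − 2 = #E_free − 3` matches
the sharp Gaussian count `(d−1)L^d + 1 − d` of the holonomy-conditioned LOWER bound (★w7's T4-LOW), so the (T4) sandwich closes with
an `L`-INDEPENDENT slack — the γ-uniform cure of the `β^{c∕n}` residual of ✓`LocalInsertionExpMomentSU2Torus`.

HONEST SCOPE.  Finite combinatorics; no measure, no estimate of Bałaban's papers; nothing of (T4), of LINE #13's stubs, of `HistoryTailL`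
or of any crux is proved.  YM₃ on T³ is rung R3 — not d = 4, not infinite volume, not a mass gap, not Clay.
-/

set_option autoImplicit false

noncomputable section

open Finset
open Literature.MathematicalPhysics.QuantumFieldTheory

namespace Summit.QuantumFields.YangMills.Theorems.LocalInsertion.TorusTopLinkD3

open Summit.QuantumFields.YangMills.Theorems.FemtoCurvatureTwoPointC.TorusGauge.TopLink
  (val_one_of_two_le val_add_one_of_lt card_filter_val_succ_lt)
open Summit.QuantumFields.YangMills.Theorems.FemtoCurvatureTwoPointC.TorusGauge.TopLinkSharp
  (add_one_eq_zero_of_not_lt card_filter_not_val_succ_lt)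

-- adapted from Summits/QuantumFields/YangMills/Theorems/LangevinControlUVFemtoCurvatureTwoPointCTorusTopLinkSharp.lean (d = 4 → d = 3)

namespace TopLinkSharp

open TopLink

variable {L : ℕ}

/-! ## Wrap-around arithmetic in `ZMod L` -/

/-- Coordinates (as naturals) of `x + e_μ` when the `μ`-th coordinate does not wrap: only the
`μ`-th one moves, by `+1`. -/
theorem val_shift_of_lt (hL : 2 ≤ L) (x : Site 3 L) (μ : Fin 3) (hx : (x μ).val + 1 < L)
    (i : Fin 3) : (x.shift μ i).val = (x i).val + if i = μ then 1 else 0 := by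
  rw [shift_apply]
  split_ifs with h
  · subst h
    exact val_add_one_of_lt hL hx
  · rw [add_zero, add_zero]

/-- Coordinates (as naturals) of `x + e_μ` when the `μ`-th coordinate wraps (`x_μ = L − 1`): the
`μ`-th one becomes `0`, the others do not move. -/
theorem val_shift_of_not_lt [NeZero L] (x : Site 3 L) (μ : Fin 3) (hx : ¬(x μ).val + 1 < L)
    (i : Fin 3) : (x.shift μ i).val = if i = μ then 0 else (x i).val := by
  rw [shift_apply]
  split_ifs with h
  · subst h
    rw [add_one_eq_zero_of_not_lt hx, ZMod.val_zero]
  · rw [add_zero]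

/-! ## The rank: coordinate-0-major, doubled digits, links offset by one -/

/-- **The rank data.** For `L ≥ 2` there are a base-point code `b : Site → ℕ` and direction weights
`w : Fin 3 → ℕ` (namely `b x = Σᵢ 2 xᵢ W^(3−i)`, `w μ = W^(3−μ)`, `W = 2L`) such that the rank
`rk (x, μ) = b x + w μ` — the `W`-adic integer with digits `2 xᵢ + [i = μ]`, coordinate `0` most
significant — is injective on links, the weights are antitone in the direction, a non-wrapping
shift in direction `μ` raises the code by `2 w μ`, and a wrapping shift does not raise it. -/
theorem exists_rank [NeZero L] (hL : 2 ≤ L) : ∃ (b : Site 3 L → ℕ) (w : Fin 3 → ℕ),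
    (Function.Injective fun e : Edge 3 L => b e.1 + w e.2) ∧
    (∀ μ ν : Fin 3, μ ≤ ν → w ν ≤ w μ) ∧
    (∀ (x : Site 3 L) (μ : Fin 3), (x μ).val + 1 < L → b (x.shift μ) = b x + 2 * w μ) ∧
    (∀ (x : Site 3 L) (μ : Fin 3), ¬(x μ).val + 1 < L → b (x.shift μ) ≤ b x) := by
  -- the digit string `dg` of a link, least significant first: digit `i` reads coordinate `3 - i`
  have hlt : ∀ (a : ZMod L) (μ ν : Fin 3), 2 * a.val + (if μ = ν then 1 else 0) < 2 * L :=
    fun a μ ν => by have := ZMod.val_lt a; split_ifs <;> omega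
  obtain ⟨dg, hdg⟩ : ∃ dg : Edge 3 L → Fin 3 → Fin (2 * L), ∀ e i,
      ((dg e i : Fin (2 * L)) : ℕ) = 2 * (e.1 (Fin.rev i)).val + if Fin.rev i = e.2 then 1 else 0 :=
    ⟨fun e i => ⟨_, hlt (e.1 (Fin.rev i)) (Fin.rev i) e.2⟩, fun _ _ => rfl⟩
  have hdg_inj : Function.Injective dg := by
    rintro ⟨x, μ⟩ ⟨y, ν⟩ h
    have hd : ∀ i : Fin 3,
        2 * (x i).val + (if i = μ then 1 else 0) = 2 * (y i).val + if i = ν then 1 else 0 := by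
      intro i
      have := congrArg (fun f : Fin 3 → Fin (2 * L) => ((f (Fin.rev i) : Fin (2 * L)) : ℕ)) h
      simpa only [hdg, Fin.rev_rev] using this
    have hμν : μ = ν := by
      by_contra hne; have := hd μ; rw [if_pos rfl, if_neg hne] at this; omega
    subst hμν
    have hxy : x = y := funext fun i => ZMod.val_injective L (by
      have := hd i
      split_ifs at this <;> omega)
    rw [hxy]
  have hrk : ∀ e : Edge 3 L, ((finFunctionFinEquiv (dg e) : Fin ((2 * L) ^ 3)) : ℕ) =
      ∑ i : Fin 3, 2 * (e.1 (Fin.rev i)).val * (2 * L) ^ (i : ℕ) + (2 * L) ^ (Fin.rev e.2 : ℕ) :=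
    fun e => by simp only [finFunctionFinEquiv_apply, hdg, add_mul, Finset.sum_add_distrib, ite_mul,
      one_mul, zero_mul, Fin.rev_eq_iff, Finset.sum_ite_eq', Finset.mem_univ, if_true]
  refine ⟨fun x => ∑ i : Fin 3, 2 * (x (Fin.rev i)).val * (2 * L) ^ (i : ℕ),
    fun μ => (2 * L) ^ (Fin.rev μ : ℕ), fun e e' h => ?_, fun μ ν h => ?_, fun x μ hx => ?_,
    fun x μ hx => ?_⟩
  · -- injectivity: `b e.1 + w e.2` is the `W`-adic number with digit string `dg e`
    exact hdg_inj (finFunctionFinEquiv.injective (Fin.ext (by rw [hrk, hrk]; exact h)))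
  · exact Nat.pow_le_pow_right (by omega) (Fin.rev_le_rev.2 h)
  · simp only [val_shift_of_lt hL x μ hx, mul_add, add_mul, Finset.sum_add_distrib, mul_ite,
      mul_one, mul_zero, ite_mul, zero_mul, Fin.rev_eq_iff, Finset.sum_ite_eq', Finset.mem_univ,
      if_true]
  · refine Finset.sum_le_sum fun i _ => ?_
    rw [val_shift_of_not_lt x μ hx]
    split_ifs <;> simp

/-! ## Maximal rank of the assigned link among the four links of its plaquette -/

/-- **Maximal rank, bulk plaquettes.** For a plaquette `p = (x; μ < ν)` whose `μ`-th coordinate does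
not wrap, each of its four links `(x, μ)`, `(x + e_μ, ν)`, `(x + e_ν, μ)`, `(x, ν)` has rank
`b · + w ·` at most that of `(x + e_μ, ν)`. -/
theorem rank_le_topA {b : Site 3 L → ℕ} {w : Fin 3 → ℕ} (hw : ∀ μ ν : Fin 3, μ ≤ ν → w ν ≤ w μ)
    (hshift : ∀ (x : Site 3 L) (μ : Fin 3), (x μ).val + 1 < L → b (x.shift μ) = b x + 2 * w μ)
    (hwrap : ∀ (x : Site 3 L) (μ : Fin 3), ¬(x μ).val + 1 < L → b (x.shift μ) ≤ b x)
    {p : Plaquette 3 L} (hp : (p.1 p.2.1.1).val + 1 < L) :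
    ∀ e ∈ ({(p.1, p.2.1.1), (p.1.shift p.2.1.1, p.2.1.2), (p.1.shift p.2.1.2, p.2.1.1),
      (p.1, p.2.1.2)} : Finset (Edge 3 L)), b e.1 + w e.2 ≤ b (p.1.shift p.2.1.1) + w p.2.1.2 := by
  obtain ⟨x, ⟨⟨μ, ν⟩, hμν⟩⟩ := p
  have hA : b (x.shift μ) = b x + 2 * w μ := hshift x μ hp
  have hνμ : w ν ≤ w μ := hw μ ν hμν.le
  intro e he
  simp only [Finset.mem_insert, Finset.mem_singleton] at he
  rcases he with rfl | rfl | rfl | rfl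
  · show b x + w μ ≤ b (x.shift μ) + w ν; omega
  · exact le_rfl
  · show b (x.shift ν) + w μ ≤ b (x.shift μ) + w ν
    by_cases hν : (x ν).val + 1 < L
    · have := hshift x ν hν; omega
    · have := hwrap x ν hν; omega
  · show b x + w ν ≤ b (x.shift μ) + w ν; omega

/-- **Maximal rank, wrap plaquettes.** For a plaquette `p = (x; μ < ν)` whose `μ`-th coordinate
wraps (`x_μ = L − 1`) but whose `ν`-th does not, each of its four links has rank `b · + w ·` at most
that of `(x + e_ν, μ)`. -/
theorem rank_le_topB {b : Site 3 L → ℕ} {w : Fin 3 → ℕ}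
    (hshift : ∀ (x : Site 3 L) (μ : Fin 3), (x μ).val + 1 < L → b (x.shift μ) = b x + 2 * w μ)
    (hwrap : ∀ (x : Site 3 L) (μ : Fin 3), ¬(x μ).val + 1 < L → b (x.shift μ) ≤ b x)
    {p : Plaquette 3 L} (hp : ¬(p.1 p.2.1.1).val + 1 < L) (hp' : (p.1 p.2.1.2).val + 1 < L) :
    ∀ e ∈ ({(p.1, p.2.1.1), (p.1.shift p.2.1.1, p.2.1.2), (p.1.shift p.2.1.2, p.2.1.1),
      (p.1, p.2.1.2)} : Finset (Edge 3 L)), b e.1 + w e.2 ≤ b (p.1.shift p.2.1.2) + w p.2.1.1 := by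
  obtain ⟨x, ⟨⟨μ, ν⟩, hμν⟩⟩ := p
  have hB : b (x.shift ν) = b x + 2 * w ν := hshift x ν hp'
  have hμ : b (x.shift μ) ≤ b x := hwrap x μ hp
  intro e he
  simp only [Finset.mem_insert, Finset.mem_singleton] at he
  rcases he with rfl | rfl | rfl | rfl
  · show b x + w μ ≤ b (x.shift ν) + w μ; omega
  · show b (x.shift μ) + w ν ≤ b (x.shift ν) + w μ; omega
  · exact le_rfl
  · show b x + w ν ≤ b (x.shift ν) + w μ; omega

/-! ## Injectivity of the assignment -/

/-- If `x + e_μ = y + e_ν` with `μ ≠ ν` and no wrap at `x_μ`, then `y_μ ≠ 0` (evaluate at `μ`: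
`y_μ = x_μ + 1` has value `x_μ + 1 ≠ 0`). -/
theorem apply_ne_zero_of_shift_eq (hL : 2 ≤ L) {x y : Site 3 L} {μ ν : Fin 3}
    (hx : (x μ).val + 1 < L) (hne : μ ≠ ν) (h : x.shift μ = y.shift ν) : y μ ≠ 0 := by
  intro hy
  have h1 := congrFun h μ
  rw [shift_apply, shift_apply, if_pos rfl, if_neg hne, add_zero, hy] at h1
  have h2 := congrArg ZMod.val h1
  rw [val_add_one_of_lt hL hx, ZMod.val_zero] at h2
  exact Nat.succ_ne_zero _ h2

/-- **No collision between the two families.** The top link `(x + e_μ, ν)` of a bulk plaquette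
`(x; μ < ν)` (no wrap at `x_μ`) is never the top link `(y + e_{ν'}, μ')` of a wrap plaquette
`(y; μ' < ν')` (with `y_i = 0` for `i < ν'`, `i ≠ μ'`): the directions force `μ < ν = μ' < ν'`, and
evaluating the sites at `μ` gives `x_μ + 1 = y_μ = 0`, a wrap. -/
theorem topA_ne_topB (hL : 2 ≤ L) {p q : Plaquette 3 L} (hp : (p.1 p.2.1.1).val + 1 < L)
    (hq : ∀ i : Fin 3, i < q.2.1.2 → i ≠ q.2.1.1 → q.1 i = 0) :
    (p.1.shift p.2.1.1, p.2.1.2) ≠ (q.1.shift q.2.1.2, q.2.1.1) := by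
  obtain ⟨x, ⟨⟨μ, ν⟩, hμν⟩⟩ := p
  obtain ⟨y, ⟨⟨μ', ν'⟩, hμν'⟩⟩ := q
  intro h
  obtain ⟨h1, h2⟩ := Prod.mk.inj h
  subst h2
  exact apply_ne_zero_of_shift_eq hL hp (hμν.trans hμν').ne h1 (hq μ (hμν.trans hμν') hμν.ne)

/-- **Injectivity on the wrap family.** The assignment `(x; μ, ν) ↦ (x + e_ν, μ)` is injective on
the plaquettes `(x; μ < ν)` with `x_μ = L − 1`, `x_ν ≠ L − 1` and `x_i = 0` for `i < ν`, `i ≠ μ`: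
equal images have equal `μ`; if `ν < ν'`, evaluating the sites at `ν` gives `x_ν + 1 = y_ν = 0`, a
wrap; so `ν = ν'` and the sites cancel. -/
theorem injOn_topB [NeZero L] (hL : 2 ≤ L) {C : Fin 3 → Fin 3 → Finset (Site 3 L)}
    (hC : ∀ (μ ν : Fin 3) (x : Site 3 L), μ < ν → (x ∈ C μ ν ↔
      ¬(x μ).val + 1 < L ∧ (x ν).val + 1 < L ∧ ∀ i : Fin 3, i < ν → i ≠ μ → x i = 0)) :
    Set.InjOn (fun p : Plaquette 3 L => (p.1.shift p.2.1.2, p.2.1.1))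
      ↑(univ.filter fun p : Plaquette 3 L => p.1 ∈ C p.2.1.1 p.2.1.2) := by
  rintro ⟨x, ⟨⟨μ, ν⟩, hμν⟩⟩ hx ⟨y, ⟨⟨μ', ν'⟩, hμν'⟩⟩ hy h
  simp only [Finset.coe_filter, Finset.mem_univ, true_and, Set.mem_setOf_eq] at hx hy
  rw [hC _ _ _ hμν] at hx
  rw [hC _ _ _ hμν'] at hy
  obtain ⟨h1, h2⟩ := Prod.mk.inj h
  subst h2
  have hν : ν = ν' := by
    by_contra hne
    rcases lt_or_gt_of_ne hne with hlt | hlt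
    · exact apply_ne_zero_of_shift_eq hL hx.2.1 hne h1 (hy.2.2 ν hlt hμν.ne')
    · exact apply_ne_zero_of_shift_eq hL hy.2.1 (Ne.symm hne) h1.symm (hx.2.2 ν' hlt hμν'.ne')
  subst hν
  have hxy : x = y := add_right_cancel (h1 : x + Pi.single ν 1 = y + Pi.single ν 1)
  subst hxy
  rfl

/-- **Injectivity of the combined assignment** `top (x; μ, ν) = (x + e_μ, ν)` if `x_μ ≠ L − 1`, else
`(x + e_ν, μ)`, on the union of the bulk family (the landed `TopLink.injOn_top`) and the wrap family
(`TopLinkSharp.injOn_topB`); mixed collisions are excluded by `TopLinkSharp.topA_ne_topB`. -/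
theorem injOn_top [NeZero L] (hL : 2 ≤ L) {B : Fin 3 → Finset (Site 3 L)}
    {C : Fin 3 → Fin 3 → Finset (Site 3 L)}
    (hB : ∀ (μ : Fin 3) (x : Site 3 L), x ∈ B μ ↔ (x μ).val + 1 < L ∧ ∀ i : Fin 3, i < μ → x i = 0)
    (hC : ∀ (μ ν : Fin 3) (x : Site 3 L), μ < ν → (x ∈ C μ ν ↔
      ¬(x μ).val + 1 < L ∧ (x ν).val + 1 < L ∧ ∀ i : Fin 3, i < ν → i ≠ μ → x i = 0)) :
    Set.InjOn (fun p : Plaquette 3 L => if (p.1 p.2.1.1).val + 1 < L then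
        (p.1.shift p.2.1.1, p.2.1.2) else (p.1.shift p.2.1.2, p.2.1.1))
      ↑((univ.filter fun p : Plaquette 3 L => p.1 ∈ B p.2.1.1) ∪
        (univ.filter fun p : Plaquette 3 L => p.1 ∈ C p.2.1.1 p.2.1.2)) := by
  have hA' : ∀ p ∈ (univ.filter fun p : Plaquette 3 L => p.1 ∈ B p.2.1.1),
      (p.1 p.2.1.1).val + 1 < L := fun p hp => ((hB _ _).1 (Finset.mem_filter.1 hp).2).1
  have hB' : ∀ p ∈ (univ.filter fun p : Plaquette 3 L => p.1 ∈ C p.2.1.1 p.2.1.2),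
      ¬(p.1 p.2.1.1).val + 1 < L ∧ (p.1 p.2.1.2).val + 1 < L ∧
        ∀ i : Fin 3, i < p.2.1.2 → i ≠ p.2.1.1 → p.1 i = 0 :=
    fun p hp => (hC _ _ _ p.2.2).1 (Finset.mem_filter.1 hp).2
  intro p hp q hq h
  rw [Finset.coe_union, Set.mem_union, Finset.mem_coe, Finset.mem_coe] at hp hq
  rcases hp with hp | hp <;> rcases hq with hq | hq
  · simp only [if_pos (hA' p hp), if_pos (hA' q hq)] at h
    exact TopLink.injOn_top hL hB hp hq h
  · simp only [if_pos (hA' p hp), if_neg (hB' q hq).1] at h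
    exact absurd h (topA_ne_topB hL (hA' p hp) (hB' q hq).2.2)
  · simp only [if_neg (hB' p hp).1, if_pos (hA' q hq)] at h
    exact absurd h.symm (topA_ne_topB hL (hA' q hq) (hB' p hp).2.2)
  · simp only [if_neg (hB' p hp).1, if_neg (hB' q hq).1] at h
    exact injOn_topB hL hC hp hq h

/-! ## The wrap family: boxes of base points and the count -/

variable [NeZero L]

/-- **The boxes of the wrap family.** For directions `μ < ν` the base points `x` with `x_μ = L − 1`,
`x_ν ≠ L − 1` (as naturals: `¬ x_μ + 1 < L`, `x_ν + 1 < L`) and `x_i = 0` for `i < ν`, `i ≠ μ` form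
a box (`Fintype.piFinset`) of size `∏ᵢ #slotᵢ` with `#slotᵢ = 1` (`i = μ`), `L − 1` (`i = ν`), `1`
(other `i < ν`), `L` (`i > ν`). -/
theorem exists_wrapBoxes : ∃ C : Fin 3 → Fin 3 → Finset (Site 3 L),
    (∀ (μ ν : Fin 3) (x : Site 3 L), μ < ν → (x ∈ C μ ν ↔
      ¬(x μ).val + 1 < L ∧ (x ν).val + 1 < L ∧ ∀ i : Fin 3, i < ν → i ≠ μ → x i = 0)) ∧
    ∀ μ ν : Fin 3, μ < ν → (C μ ν).card =
      ∏ i : Fin 3, (if i = μ then 1 else if i = ν then L - 1 else if i < ν then 1 else L) := by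
  refine ⟨fun μ ν => Fintype.piFinset fun i =>
      if i = μ then univ.filter (fun a : ZMod L => ¬a.val + 1 < L) else
      if i = ν then univ.filter (fun a : ZMod L => a.val + 1 < L) else
      if i < ν then {0} else univ, fun μ ν x hμν => ?_, fun μ ν hμν => ?_⟩
  · rw [Fintype.mem_piFinset]
    constructor
    · intro h
      exact ⟨by simpa using h μ, by simpa [hμν.ne'] using h ν,
        fun i hi hiμ => by simpa [hiμ, hi.ne, hi] using h i⟩
    · rintro ⟨h1, h2, h3⟩ i
      split_ifs with hiμ hiν hi
      · subst hiμ
        exact Finset.mem_filter.2 ⟨Finset.mem_univ _, h1⟩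
      · subst hiν
        exact Finset.mem_filter.2 ⟨Finset.mem_univ _, h2⟩
      · exact Finset.mem_singleton.2 (h3 i hi hiμ)
      · exact Finset.mem_univ _
  · rw [Fintype.card_piFinset]
    refine Finset.prod_congr rfl fun i _ => ?_
    split_ifs with hiμ hiν hi
    · exact card_filter_not_val_succ_lt
    · exact card_filter_val_succ_lt
    · rfl
    · rw [Finset.card_univ, ZMod.card]

/-- **Count of the wrap family.** If the box for directions `μ < ν` has `∏ᵢ #slotᵢ` elements
(`1`, `L − 1`, `1`, `L` for `i = μ`, `i = ν`, other `i < ν`, `i > ν`), the wrap family has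
`(L−1) L² + 2 (L−1) L + 3 (L−1) = L³ + L² + L − 3` members: `#P_B + 2 = L² + L`. -/
theorem card_wrapFamily {C : Fin 3 → Fin 3 → Finset (Site 3 L)}
    (hC : ∀ μ ν : Fin 3, μ < ν → (C μ ν).card =
      ∏ i : Fin 3, (if i = μ then 1 else if i = ν then L - 1 else if i < ν then 1 else L)) :
    (univ.filter fun p : Plaquette 3 L => p.1 ∈ C p.2.1.1 p.2.1.2).card + 2 =
      L ^ 2 + L := by
  have h1 : (univ.filter fun p : Plaquette 3 L => p.1 ∈ C p.2.1.1 p.2.1.2).card =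
      ∑ q : {q : Fin 3 × Fin 3 // q.1 < q.2}, ∏ i : Fin 3,
        (if i = q.1.1 then 1 else if i = q.1.2 then L - 1 else if i < q.1.2 then 1 else L) := by
    calc (univ.filter fun p : Plaquette 3 L => p.1 ∈ C p.2.1.1 p.2.1.2).card
          = ∑ p : Plaquette 3 L, if p.1 ∈ C p.2.1.1 p.2.1.2 then 1 else 0 := Finset.card_filter _ _
      _ = ∑ q : {q : Fin 3 × Fin 3 // q.1 < q.2}, ∑ x : Site 3 L,
            if x ∈ C q.1.1 q.1.2 then 1 else 0 := Fintype.sum_prod_type_right _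
      _ = ∑ q : {q : Fin 3 × Fin 3 // q.1 < q.2}, (C q.1.1 q.1.2).card :=
          Finset.sum_congr rfl fun q _ => by rw [Finset.sum_ite_mem_eq, Finset.card_eq_sum_ones]
      _ = _ := Finset.sum_congr rfl fun q _ => hC _ _ q.2
  rw [h1, ← Finset.sum_subtype (p := fun q : Fin 3 × Fin 3 => q.1 < q.2)
    (univ.filter fun q : Fin 3 × Fin 3 => q.1 < q.2) (fun _ => by simp)
    (fun q : Fin 3 × Fin 3 => ∏ i : Fin 3,
      (if i = q.1 then 1 else if i = q.2 then L - 1 else if i < q.2 then 1 else L)),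
    Finset.sum_filter]
  simp only [Fintype.sum_prod_type, Fin.sum_univ_three, Fin.prod_univ_three]
  simp
  obtain ⟨M, rfl⟩ : ∃ M, L = M + 1 := ⟨L - 1, (Nat.succ_pred_eq_of_ne_zero (NeZero.ne L)).symm⟩
  simp only [Nat.add_sub_cancel]
  ring

end TopLinkSharp

/-! ## The registered statement -/

/-- **Sharp top-link assignment on the 3-torus.** For `L ≥ 2` there are a family `P` of `2L³ − 2`
plaquettes of the torus `(ℤ/L)³`, a map `top` assigning to each of them one of its four links, and an
injective rank on links such that `top` is injective on `P` and `top p` has maximal rank among the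
four links of `p`. (Rank: the `2L`-adic integer with digits `2 xᵢ + [i = μ]`, coordinate `0` most
significant; family: bulk plaquettes `(x; μ < ν)`, `x_μ ≠ L − 1`, `x_i = 0` (`i < μ`), assigned
`(x + e_μ, ν)`, and wrap plaquettes, `x_μ = L − 1`, `x_ν ≠ L − 1`, `x_i = 0` (`i < ν`, `i ≠ μ`),
assigned `(x + e_ν, μ)`; see the module docstring and the namespace `TopLinkSharp`.) -/
theorem torus_topLink_assignment_sharp_d3 : ∀ (L : ℕ) [NeZero L], 2 ≤ L →
    ∃ (P : Finset (Plaquette 3 L)) (top : Plaquette 3 L → Edge 3 L) (rk : Edge 3 L → ℕ),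
      Function.Injective rk ∧ Set.InjOn top ↑P ∧ P.card + 2 = 2 * L ^ 3 ∧
      ∀ p ∈ P,
        top p ∈ ({(p.1, p.2.1.1), (p.1.shift p.2.1.1, p.2.1.2), (p.1.shift p.2.1.2, p.2.1.1), (p.1, p.2.1.2)} :
          Finset (Edge 3 L)) ∧
        ∀ e ∈ ({(p.1, p.2.1.1), (p.1.shift p.2.1.1, p.2.1.2), (p.1.shift p.2.1.2, p.2.1.1), (p.1, p.2.1.2)} :
          Finset (Edge 3 L)), rk e ≤ rk (top p) := by
  intro L _ hL
  obtain ⟨b, w, hrk, hw, hshift, hwrap⟩ := TopLinkSharp.exists_rank (L := L) hL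
  obtain ⟨B, hB_mem, hB_card⟩ := TopLink.exists_boxes (L := L)
  obtain ⟨C, hC_mem, hC_card⟩ := TopLinkSharp.exists_wrapBoxes (L := L)
  refine ⟨(univ.filter fun p : Plaquette 3 L => p.1 ∈ B p.2.1.1) ∪
      (univ.filter fun p : Plaquette 3 L => p.1 ∈ C p.2.1.1 p.2.1.2),
    fun p => if (p.1 p.2.1.1).val + 1 < L then (p.1.shift p.2.1.1, p.2.1.2)
      else (p.1.shift p.2.1.2, p.2.1.1),
    fun e => b e.1 + w e.2, hrk, TopLinkSharp.injOn_top hL hB_mem hC_mem, ?_, fun p hp => ⟨?_, ?_⟩⟩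
  · -- the count `#P_A + #P_B + 2 = 2L³` (the families are disjoint: `x_μ ≠ L − 1` vs `x_μ = L − 1`)
    rw [Finset.card_union_of_disjoint (Finset.disjoint_left.2 fun p hpA hpB =>
      ((hC_mem _ _ _ p.2.2).1 (Finset.mem_filter.1 hpB).2).1
        ((hB_mem _ _).1 (Finset.mem_filter.1 hpA).2).1)]
    have h1 := TopLink.card_family hB_card
    have h2 := TopLinkSharp.card_wrapFamily hC_card
    omega
  · -- `top p` is a link of `p`
    dsimp only
    split_ifs <;> simp
  · -- `top p` has maximal rank among the links of `p`
    dsimp only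
    by_cases h : (p.1 p.2.1.1).val + 1 < L
    · rw [if_pos h]
      exact TopLinkSharp.rank_le_topA hw hshift hwrap h
    · rw [if_neg h]
      have hpB := (Finset.mem_union.1 hp).resolve_left fun hpA =>
        h ((hB_mem _ _).1 (Finset.mem_filter.1 hpA).2).1
      exact TopLinkSharp.rank_le_topB hshift hwrap h
        ((hC_mem _ _ _ p.2.2).1 (Finset.mem_filter.1 hpB).2).2.1

end Summit.QuantumFields.YangMills.Theorems.LocalInsertion.TorusTopLinkD3

end
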